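import Literature.Analysis.FluidPDE.EulerReynolds
import Literature.Analysis.FunctionSpaces.TorusInverseLaplacian
import Literature.Analysis.FunctionSpaces.TorusEnstrophyOrthogonality
import HarnessLib

/-!
# The De Lellis–Székelyhidi tensor-valued antidivergence `ℛ` on the flat torus

Analysis/FluidPDE support file. On `T^d`, `d ≥ 2`, every smooth vector field `v` is the
(row-wise) divergence of a smooth **symmetric, trace-free** matrix field, up to its mean:
Cheskidov–Luo 2022, §7.2 (= App. B), Def. 7.2, recall the operator of De Lellis–Székelyhidi
(Invent. Math. 193 (2013), §4)

  `ℛ : C^∞(𝕋^d, ℝ^d) → C^∞(𝕋^d, 𝒮₀^{d×d})`,  `(ℛv)ᵢⱼ = ℛᵢⱼₖ vₖ`,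
  `ℛᵢⱼₖ = (2-d)/(d-1) Δ⁻²∂ᵢ∂ⱼ∂ₖ - 1/(d-1) Δ⁻¹∂ₖ δᵢⱼ + Δ⁻¹∂ᵢ δⱼₖ + Δ⁻¹∂ⱼ δᵢₖ`

("`ℛ` is well-defined since `ℛᵢⱼₖ` is symmetric in `i,j` and taking the trace gives `0`";
"`div (ℛv) = v - ⨍ v` for any `v ∈ C^∞(𝕋^d, ℝ^d)`"). The printed display carries a leading minus
sign on the first term which the paper's own trace computation two lines below does not use; with
the coefficient `+(2-d)/(d-1)` (as here, and as forced by `tr ℛv = 0` **and** `div ℛv = v - ⨍v`)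
both identities hold, see `antidivergence_trace` and `tensorDivergence_antidivergence`.

With `u = Δ⁻¹ v` (componentwise, `Torus.invLaplacian` of `TorusInverseLaplacian`), `D = div u`
and `φ = Δ⁻¹ D`, the entries are

  `(ℛv)ᵢⱼ = ∂ᵢuⱼ + ∂ⱼuᵢ - (1/(d-1)) δᵢⱼ D + ((2-d)/(d-1)) ∂ᵢ∂ⱼφ`,

and `∑ⱼ ∂ⱼ(ℛv)ᵢⱼ = Δuᵢ + (1 - 1/(d-1) + (2-d)/(d-1)) ∂ᵢD = vᵢ - ⨍vᵢ`,
`tr ℛv = (2 - d/(d-1) + (2-d)/(d-1)) D - ((2-d)/(d-1)) ⨍D = 0` (`⨍ D = 0`, a divergence).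

## Contents (all proved)

* `Torus.antidivEntry v i j`, `Torus.antidivergence v` — the entries and the matrix field stored
  by columns (`antidivergence v x j = (ℛv)(x) eⱼ ∈ ℝ^d`, the convention of
  `Torus.tensorDivergence` / `Torus.IsEulerReynoldsOn`);
* `Torus.isSmooth_antidivergence`, `Torus.antidivergence_symm`, `Torus.antidivergence_trace`
  (`d ≥ 2`), `Torus.tensorDivergence_antidivergence` (`div ℛv = v - ∫ v`, `d ≥ 2`);
* `Torus.IsSmoothSpaceTimeOn.antidivergence` — joint space–time smoothness of `t ↦ ℛ(f t)` for
  jointly smooth `f` on convex time sets with nonempty interior (from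
  `Torus.IsSmoothSpaceTimeOn.invLaplacian`).

The `Lᵖ` bounds of CL22 Thm. 7.3 and the bilinear version `ℬ` (§7.3) are not treated here.

## References

* A. Cheskidov, X. Luo, *Sharp nonuniqueness for the Navier–Stokes equations*, Invent. Math. 229
  (2022) 987–1054 = arXiv:2009.06596, §7.2 Def. 7.2. [`CheskidovLuo2022`]
* C. De Lellis, L. Székelyhidi Jr., *Dissipative continuous Euler flows*, Invent. Math. 193
  (2013), 377–407, §4.1 (the operator `ℛ`, `d = 3`). [`DeLellisSzekelyhidiInvent2013`]
-/

noncomputable section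

open MeasureTheory Set Filter Topology Function
open scoped ContDiff

namespace Literature.Analysis.FluidPDE

namespace Torus

open FunctionSpaces FunctionSpaces.Torus

variable {d : Type*} [Fintype d] [DecidableEq d]

/-! ## Pointwise calculus helpers -/

section Helpers

variable {F : Type*} [NormedAddCommGroup F] [NormedSpace ℝ F]

/-- `∂ₗ (f + g) (x) = ∂ₗ f (x) + ∂ₗ g (x)` for `C¹` functions (pointwise form). [folklore] -/
theorem partialDeriv_add_apply {f g : UnitAddTorus d → F} (hf : IsContDiff 1 f) (hg : IsContDiff 1 g)
    (l : d) (x : UnitAddTorus d) :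
    partialDeriv l (fun y => f y + g y) x = partialDeriv l f x + partialDeriv l g x :=
  congr_fun (partialDeriv_add hf hg l) x

/-- `∂ₗ (c • f) (x) = c • ∂ₗ f (x)` for `C¹` functions (pointwise form of the accepted
`Torus.partialDeriv_const_smul`; cf. the same statement `partialDeriv_const_smul_apply` in
`FluidPDE/LerayHopfTimeSliceTorus`, not imported here). [folklore] -/
theorem partialDeriv_const_smul_at {f : UnitAddTorus d → F} (hf : IsContDiff 1 f) (c : ℝ)
    (l : d) (x : UnitAddTorus d) :
    partialDeriv l (fun y => c • f y) x = c • partialDeriv l f x :=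
  congr_fun (partialDeriv_const_smul hf c l) x

/-- `∂ₗ (f - g) (x) = ∂ₗ f (x) - ∂ₗ g (x)` for `C¹` functions (pointwise form; cf. the same
statement `partialDeriv_sub_apply` in `FluidPDE/NSHopfGalerkinLimit`, not imported here). [folklore] -/
theorem partialDeriv_sub_at {f g : UnitAddTorus d → F} (hf : IsContDiff 1 f) (hg : IsContDiff 1 g)
    (l : d) (x : UnitAddTorus d) :
    partialDeriv l (fun y => f y - g y) x = partialDeriv l f x - partialDeriv l g x := by
  have h1 : (fun y => f y - g y) = f + (-1 : ℝ) • g := by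
    funext y; simp [sub_eq_add_neg]
  rw [h1, partialDeriv_add hf (hg.smul (-1)), Pi.add_apply, partialDeriv_const_smul hg, Pi.smul_apply]
  simp [sub_eq_add_neg]

/-- `∂ₗ (c * f) (x) = c * ∂ₗ f (x)` for `C¹` real functions. [folklore] -/
theorem partialDeriv_const_mul_apply {f : UnitAddTorus d → ℝ} (hf : IsContDiff 1 f) (c : ℝ)
    (l : d) (x : UnitAddTorus d) :
    partialDeriv l (fun y => c * f y) x = c * partialDeriv l f x :=
  partialDeriv_const_smul_at hf c l x

omit [Fintype d] in
/-- Partial derivatives of constants vanish. [folklore] -/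
theorem partialDeriv_const_apply (c : F) (l : d) (x : UnitAddTorus d) :
    partialDeriv l (fun _ : UnitAddTorus d => c) x = 0 := by
  simp [FunctionSpaces.Torus.partialDeriv, FunctionSpaces.Torus.lineDeriv]

omit [DecidableEq d] in
/-- Finite sums of smooth functions are smooth. [folklore] -/
theorem isSmooth_finset_sum {ι : Type*} (s : Finset ι) {f : ι → UnitAddTorus d → F}
    (hf : ∀ l ∈ s, IsSmooth (f l)) : IsSmooth (fun y => ∑ l ∈ s, f l y) := by
  have hl : lift (fun y => ∑ l ∈ s, f l y) = fun z => ∑ l ∈ s, lift (f l) z := rfl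
  unfold IsSmooth
  rw [hl]
  exact ContDiff.sum fun l hl => hf l hl

/-- `∑ⱼ ∂ⱼ∂ᵢ∂ⱼ f = ∂ᵢ Δf` for smooth `f` (Schwarz and `Δ = ∑ⱼ ∂ⱼ∂ⱼ`). [folklore] -/
theorem sum_partialDeriv_partialDeriv_partialDeriv {f : UnitAddTorus d → F} (hf : IsSmooth f) (i : d)
    (x : UnitAddTorus d) :
    ∑ j, partialDeriv j (partialDeriv i (partialDeriv j f)) x = partialDeriv i (laplacian f) x := by
  have hlap : laplacian f = fun y => ∑ j, partialDeriv j (partialDeriv j f) y :=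
    funext (laplacian_eq_sum_partialDeriv_partialDeriv hf)
  rw [hlap, partialDeriv_finset_sum _ fun j _ =>
    ((hf.partialDeriv j).partialDeriv j).isContDiff (by simp)]
  refine Finset.sum_congr rfl fun j _ => ?_
  rw [partialDeriv_comm (hf.partialDeriv j) i j x]

end Helpers

/-! ## The operator `ℛ` -/

section Antidivergence

/-- The potentials of the antidivergence: `uⱼ = Δ⁻¹ vⱼ` (componentwise inverse Laplacian of the
vector field `v`, `Torus.invLaplacian`). [cite: CheskidovLuo2022, §7.2 Def. 7.2] -/
def antidivPotential (v : UnitAddTorus d → EuclideanSpace ℝ d) (j : d) : UnitAddTorus d → ℝ :=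
  invLaplacian fun x => v x j

/-- `D = div u = ∑ₗ ∂ₗ uₗ`, `u = Δ⁻¹ v`. [cite: CheskidovLuo2022, §7.2 Def. 7.2] -/
def antidivDiv (v : UnitAddTorus d → EuclideanSpace ℝ d) : UnitAddTorus d → ℝ :=
  fun x => ∑ l, partialDeriv l (antidivPotential v l) x

/-- `φ = Δ⁻¹ div Δ⁻¹ v` (so that `∂ᵢ∂ⱼφ` realises `Δ⁻²∂ᵢ∂ⱼ∂ₖvₖ`). [cite: CheskidovLuo2022, §7.2 Def. 7.2] -/
def antidivPhi (v : UnitAddTorus d → EuclideanSpace ℝ d) : UnitAddTorus d → ℝ :=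
  invLaplacian (antidivDiv v)

/-- The entries of the **De Lellis–Székelyhidi antidivergence** (Cheskidov–Luo 2022, Def. 7.2,
with the sign of the first coefficient as used in the paper's trace computation):
`(ℛv)ᵢⱼ = ∂ᵢuⱼ + ∂ⱼuᵢ - (1/(d-1)) δᵢⱼ div u + ((2-d)/(d-1)) ∂ᵢ∂ⱼ Δ⁻¹ div u`, `u = Δ⁻¹ v`.
For `#d = 1` the coefficients are the junk value `x/0 = 0`; all statements about `ℛ` assume
`2 ≤ #d`. [cite: CheskidovLuo2022, §7.2 Def. 7.2] -/
def antidivEntry (v : UnitAddTorus d → EuclideanSpace ℝ d) (i j : d) (x : UnitAddTorus d) : ℝ :=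
  partialDeriv i (antidivPotential v j) x + partialDeriv j (antidivPotential v i) x -
    (1 / ((Fintype.card d : ℝ) - 1)) * (if i = j then antidivDiv v x else 0) +
    ((2 - (Fintype.card d : ℝ)) / ((Fintype.card d : ℝ) - 1)) *
      partialDeriv i (partialDeriv j (antidivPhi v)) x

/-- **The tensor-valued antidivergence `ℛv`** of a vector field `v` on `T^d` (Cheskidov–Luo 2022,
Def. 7.2; De Lellis–Székelyhidi 2013, §4.1), stored by columns as in `Torus.tensorDivergence`:
`antidivergence v x j = (ℛv)(x) eⱼ`, i.e. `antidivergence v x j i = (ℛv)ᵢⱼ(x)`. [cite: CheskidovLuo2022, §7.2 Def. 7.2] -/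
def antidivergence (v : UnitAddTorus d → EuclideanSpace ℝ d) (x : UnitAddTorus d) (j : d) :
    EuclideanSpace ℝ d :=
  WithLp.toLp 2 fun i => antidivEntry v i j x

/-- Entries of the antidivergence. [folklore] -/
@[simp]
theorem antidivergence_apply (v : UnitAddTorus d → EuclideanSpace ℝ d) (x : UnitAddTorus d)
    (j i : d) : antidivergence v x j i = antidivEntry v i j x := rfl

variable {v : UnitAddTorus d → EuclideanSpace ℝ d}

/-! ### Smoothness -/

omit [DecidableEq d] in
/-- The potentials `uⱼ = Δ⁻¹vⱼ` are smooth. [folklore] -/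
theorem isSmooth_antidivPotential (hv : IsSmooth v) (j : d) : IsSmooth (antidivPotential v j) :=
  isSmooth_invLaplacian (hv.apply j)

/-- `D = div Δ⁻¹v` is smooth. [folklore] -/
theorem isSmooth_antidivDiv (hv : IsSmooth v) : IsSmooth (antidivDiv v) :=
  isSmooth_finset_sum _ fun l _ => (isSmooth_antidivPotential hv l).partialDeriv l

/-- `φ = Δ⁻¹ div Δ⁻¹ v` is smooth. [folklore] -/
theorem isSmooth_antidivPhi (hv : IsSmooth v) : IsSmooth (antidivPhi v) :=
  isSmooth_invLaplacian (isSmooth_antidivDiv hv)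

/-- The Kronecker-weighted divergence `δᵢⱼ D` is smooth. [folklore] -/
theorem isSmooth_ite_antidivDiv (hv : IsSmooth v) (i j : d) :
    IsSmooth (fun x => if i = j then antidivDiv v x else 0) := by
  by_cases hij : i = j
  · simp only [if_pos hij]
    exact isSmooth_antidivDiv hv
  · simp only [if_neg hij]
    exact isSmooth_const _

/-- The entries of `ℛv` are smooth. [folklore] -/
theorem isSmooth_antidivEntry (hv : IsSmooth v) (i j : d) : IsSmooth (antidivEntry v i j) := by
  have hA : IsSmooth (partialDeriv i (antidivPotential v j)) :=
    (isSmooth_antidivPotential hv j).partialDeriv i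
  have hB : IsSmooth (partialDeriv j (antidivPotential v i)) :=
    (isSmooth_antidivPotential hv i).partialDeriv j
  have hD := isSmooth_ite_antidivDiv hv i j
  have hE : IsSmooth (partialDeriv i (partialDeriv j (antidivPhi v))) :=
    ((isSmooth_antidivPhi hv).partialDeriv j).partialDeriv i
  unfold IsSmooth at hA hB hD hE ⊢
  exact ((hA.add hB).sub ((contDiff_const (c := (1 / ((Fintype.card d : ℝ) - 1)))).mul hD)).add
    ((contDiff_const (c := ((2 - (Fintype.card d : ℝ)) / ((Fintype.card d : ℝ) - 1)))).mul hE)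

/-- **`ℛv` is smooth for smooth `v`.** [cite: CheskidovLuo2022, §7.2 Def. 7.2] -/
theorem isSmooth_antidivergence (hv : IsSmooth v) : IsSmooth (antidivergence v) := by
  unfold IsSmooth
  exact contDiff_pi.2 fun j => contDiff_piLp' _ fun i => isSmooth_antidivEntry hv i j

/-! ### Symmetry and trace -/

/-- **`ℛv` is symmetric**: `(ℛv)ᵢⱼ = (ℛv)ⱼᵢ` (Schwarz for `∂ᵢ∂ⱼφ`; CL22: "`ℛᵢⱼₖ` is symmetric in
`i, j`"). [cite: CheskidovLuo2022, §7.2 Def. 7.2] -/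
theorem antidivergence_symm (hv : IsSmooth v) (x : UnitAddTorus d) (i j : d) :
    antidivergence v x i j = antidivergence v x j i := by
  simp only [antidivergence_apply, antidivEntry]
  rw [partialDeriv_comm (isSmooth_antidivPhi hv) j i x, add_comm (partialDeriv j (antidivPotential v i) x)]
  by_cases hij : i = j
  · subst hij; rfl
  · rw [if_neg hij, if_neg (Ne.symm hij)]

/-- `∫ D = 0`: the divergence `D = ∑ₗ ∂ₗuₗ` integrates to zero on the torus. [folklore] -/
theorem integral_antidivDiv (hv : IsSmooth v) : ∫ x, antidivDiv v x = 0 := by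
  unfold antidivDiv
  rw [integral_finsetSum _ fun l _ => ((isSmooth_antidivPotential hv l).partialDeriv l).integrable]
  exact Finset.sum_eq_zero fun l _ =>
    integral_partialDeriv_eq_zero_holds (isSmooth_antidivPotential hv l) l

/-- `Δφ = D`: since `∫ D = 0`, `Δ Δ⁻¹ D = D` exactly. [folklore] -/
theorem laplacian_antidivPhi [Nonempty d] (hv : IsSmooth v) (x : UnitAddTorus d) :
    laplacian (antidivPhi v) x = antidivDiv v x := by
  rw [antidivPhi, laplacian_invLaplacian (isSmooth_antidivDiv hv), integral_antidivDiv hv, sub_zero]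

/-- **`ℛv` is trace free** for `d ≥ 2`: `∑ᵢ (ℛv)ᵢᵢ = (2 - d/(d-1) + (2-d)/(d-1)) D = 0`
(CL22: "taking the trace gives `0`"). [cite: CheskidovLuo2022, §7.2 Def. 7.2] -/
theorem antidivergence_trace (hd : 2 ≤ Fintype.card d) (hv : IsSmooth v) (x : UnitAddTorus d) :
    ∑ i, antidivergence v x i i = 0 := by
  haveI : Nonempty d := Fintype.card_pos_iff.1 (by omega)
  have hN : (Fintype.card d : ℝ) - 1 ≠ 0 := by
    have : (2 : ℝ) ≤ Fintype.card d := by exact_mod_cast hd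
    linarith
  simp only [antidivergence_apply, antidivEntry, if_true]
  have hΔφ : ∑ i, partialDeriv i (partialDeriv i (antidivPhi v)) x = antidivDiv v x := by
    rw [← laplacian_eq_sum_partialDeriv_partialDeriv (isSmooth_antidivPhi hv), laplacian_antidivPhi hv]
  have hD : ∑ i, partialDeriv i (antidivPotential v i) x = antidivDiv v x := rfl
  rw [Finset.sum_add_distrib, Finset.sum_sub_distrib, Finset.sum_add_distrib, ← Finset.mul_sum,
    ← Finset.mul_sum, hΔφ, Finset.sum_const, Finset.card_univ, hD, nsmul_eq_mul]
  field_simp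
  ring

/-! ### The divergence of `ℛv` -/

/-- Partial derivatives of the entries, term by term. [folklore] -/
theorem partialDeriv_antidivEntry (hv : IsSmooth v) (i j l : d) (x : UnitAddTorus d) :
    partialDeriv l (antidivEntry v i j) x =
      partialDeriv l (partialDeriv i (antidivPotential v j)) x +
        partialDeriv l (partialDeriv j (antidivPotential v i)) x -
      (1 / ((Fintype.card d : ℝ) - 1)) * (if i = j then partialDeriv l (antidivDiv v) x else 0) +
      ((2 - (Fintype.card d : ℝ)) / ((Fintype.card d : ℝ) - 1)) *
        partialDeriv l (partialDeriv i (partialDeriv j (antidivPhi v))) x := by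
  have hA : IsContDiff 1 (partialDeriv i (antidivPotential v j)) :=
    ((isSmooth_antidivPotential hv j).partialDeriv i).isContDiff (by simp)
  have hB : IsContDiff 1 (partialDeriv j (antidivPotential v i)) :=
    ((isSmooth_antidivPotential hv i).partialDeriv j).isContDiff (by simp)
  have hD : IsContDiff 1 (fun x => if i = j then antidivDiv v x else 0) :=
    (isSmooth_ite_antidivDiv hv i j).isContDiff (by simp)
  have hE : IsContDiff 1 (partialDeriv i (partialDeriv j (antidivPhi v))) :=
    (((isSmooth_antidivPhi hv).partialDeriv j).partialDeriv i).isContDiff (by simp)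
  set c₁ : ℝ := 1 / ((Fintype.card d : ℝ) - 1) with hc₁
  set c₂ : ℝ := (2 - (Fintype.card d : ℝ)) / ((Fintype.card d : ℝ) - 1) with hc₂
  have hcD : IsContDiff 1 (fun x => c₁ * (if i = j then antidivDiv v x else 0)) :=
    ContDiff.mul contDiff_const hD
  have hcE : IsContDiff 1 (fun x => c₂ * partialDeriv i (partialDeriv j (antidivPhi v)) x) :=
    ContDiff.mul contDiff_const hE
  have hAB : IsContDiff 1 (fun x => partialDeriv i (antidivPotential v j) x +
      partialDeriv j (antidivPotential v i) x) := hA.add hB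
  have hABD : IsContDiff 1 (fun x => (partialDeriv i (antidivPotential v j) x +
      partialDeriv j (antidivPotential v i) x) - c₁ * (if i = j then antidivDiv v x else 0)) :=
    ContDiff.sub hAB hcD
  have hite : partialDeriv l (fun x => if i = j then antidivDiv v x else 0) x =
      if i = j then partialDeriv l (antidivDiv v) x else 0 := by
    by_cases hij : i = j
    · simp only [if_pos hij]
    · simp only [if_neg hij]
      exact partialDeriv_const_apply (0 : ℝ) l x
  have e1 : partialDeriv l (antidivEntry v i j) x =
      partialDeriv l (fun x => (partialDeriv i (antidivPotential v j) x +
        partialDeriv j (antidivPotential v i) x) - c₁ * (if i = j then antidivDiv v x else 0)) x +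
      partialDeriv l (fun x => c₂ * partialDeriv i (partialDeriv j (antidivPhi v)) x) x :=
    partialDeriv_add_apply
      (f := fun x => (partialDeriv i (antidivPotential v j) x +
        partialDeriv j (antidivPotential v i) x) - c₁ * (if i = j then antidivDiv v x else 0))
      (g := fun x => c₂ * partialDeriv i (partialDeriv j (antidivPhi v)) x) hABD hcE l x
  have e2 : partialDeriv l (fun x => (partialDeriv i (antidivPotential v j) x +
        partialDeriv j (antidivPotential v i) x) - c₁ * (if i = j then antidivDiv v x else 0)) x =
      partialDeriv l (fun x => partialDeriv i (antidivPotential v j) x +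
        partialDeriv j (antidivPotential v i) x) x -
      partialDeriv l (fun x => c₁ * (if i = j then antidivDiv v x else 0)) x :=
    partialDeriv_sub_at
      (f := fun x => partialDeriv i (antidivPotential v j) x + partialDeriv j (antidivPotential v i) x)
      (g := fun x => c₁ * (if i = j then antidivDiv v x else 0)) hAB hcD l x
  have e3 : partialDeriv l (fun x => partialDeriv i (antidivPotential v j) x +
        partialDeriv j (antidivPotential v i) x) x =
      partialDeriv l (partialDeriv i (antidivPotential v j)) x +
        partialDeriv l (partialDeriv j (antidivPotential v i)) x :=
    partialDeriv_add_apply hA hB l x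
  have e4 : partialDeriv l (fun x => c₁ * (if i = j then antidivDiv v x else 0)) x =
      c₁ * (if i = j then partialDeriv l (antidivDiv v) x else 0) := by
    rw [partialDeriv_const_mul_apply hD, hite]
  have e5 : partialDeriv l (fun x => c₂ * partialDeriv i (partialDeriv j (antidivPhi v)) x) x =
      c₂ * partialDeriv l (partialDeriv i (partialDeriv j (antidivPhi v))) x :=
    partialDeriv_const_mul_apply hE c₂ l x
  rw [e1, e2, e3, e4, e5]

/-- **`div (ℛv) = v - ∫ v`** for smooth `v` and `d ≥ 2` (Cheskidov–Luo 2022, §7.2: "By a direct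
computation, `div(ℛv) = v - ⨍ v`"): row-wise,
`∑ⱼ ∂ⱼ(ℛv)ᵢⱼ = Δuᵢ + ∂ᵢD - (1/(d-1)) ∂ᵢD + ((2-d)/(d-1)) ∂ᵢΔφ = vᵢ - ∫vᵢ` since `Δuᵢ = vᵢ - ∫vᵢ`,
`Δφ = D` and `1 - 1/(d-1) + (2-d)/(d-1) = 0`. Here `div` is `Torus.tensorDivergence` (columns)
and the integral is over the probability Haar measure (`⨍ = ∫`). [cite: CheskidovLuo2022, §7.2 Def. 7.2] -/
theorem tensorDivergence_antidivergence (hd : 2 ≤ Fintype.card d) (hv : IsSmooth v)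
    (x : UnitAddTorus d) : tensorDivergence (antidivergence v) x = v x - ∫ y, v y := by
  haveI : Nonempty d := Fintype.card_pos_iff.1 (by omega)
  have hN : (Fintype.card d : ℝ) - 1 ≠ 0 := by
    have : (2 : ℝ) ≤ Fintype.card d := by exact_mod_cast hd
    linarith
  have hR1 : ∀ j, IsContDiff 1 (fun y => antidivergence v y j) := fun j =>
    ((isSmooth_antidivergence hv).column j).isContDiff (by simp)
  -- work coordinate-wise
  ext i
  rw [tensorDivergence]
  simp only [WithLp.ofLp_sum, Finset.sum_apply, WithLp.ofLp_sub, Pi.sub_apply]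
  rw [eval_integral_piLp (fun i => (hv.apply i).integrable) i]
  have hcoord : ∀ j, (partialDeriv j (fun y => antidivergence v y j) x) i =
      partialDeriv j (antidivEntry v i j) x := fun j => by
    rw [← partialDeriv_apply_coord (hR1 j) j x i]
    rfl
  simp only [hcoord, partialDeriv_antidivEntry hv]
  rw [Finset.sum_add_distrib, Finset.sum_sub_distrib, Finset.sum_add_distrib, ← Finset.mul_sum,
    ← Finset.mul_sum]
  -- the four sums
  have hu : ∀ j, IsSmooth (antidivPotential v j) := isSmooth_antidivPotential hv
  have h1 : ∑ j, partialDeriv j (partialDeriv i (antidivPotential v j)) x =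
      partialDeriv i (antidivDiv v) x := by
    unfold antidivDiv
    rw [partialDeriv_finset_sum _ fun l _ => ((hu l).partialDeriv l).isContDiff (by simp)]
    exact Finset.sum_congr rfl fun j _ => partialDeriv_comm (hu j) j i x
  have h2 : ∑ j, partialDeriv j (partialDeriv j (antidivPotential v i)) x = v x i - ∫ y, v y i := by
    rw [← laplacian_eq_sum_partialDeriv_partialDeriv (hu i), antidivPotential,
      laplacian_invLaplacian (hv.apply i)]
  have h3 : ∑ j, (if i = j then partialDeriv j (antidivDiv v) x else 0) =
      partialDeriv i (antidivDiv v) x := by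
    rw [Finset.sum_ite_eq]
    simp
  have h4 : ∑ j, partialDeriv j (partialDeriv i (partialDeriv j (antidivPhi v))) x =
      partialDeriv i (antidivDiv v) x := by
    rw [sum_partialDeriv_partialDeriv_partialDeriv (isSmooth_antidivPhi hv) i x,
      show laplacian (antidivPhi v) = antidivDiv v from funext (laplacian_antidivPhi hv)]
  rw [h1, h2, h3, h4]
  field_simp
  ring

/-! ### Joint space–time smoothness -/

/-- **`t ↦ ℛ(f t)` is jointly smooth on `S × T^d` for jointly smooth `f`**, `S` a convex time set
with nonempty interior (`[0, T]`, `[0, ∞)`, …; one-sided at the endpoints): all ingredients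
(`Δ⁻¹` slice-wise, `TorusInverseLaplacian`; spatial derivatives, `TorusSpaceTime`) preserve joint
smoothness. This is how `ℛ` is used in the first step of Cheskidov–Luo 2022, §2.6
(`R₀ = ℛ(∂ₜu₀ - Δu₀ + div(u₀ ⊗ u₀))` is a smooth Reynolds stress on `[0,T] × 𝕋^d`). [cite: CheskidovLuo2022, §7.2 Def. 7.2] -/
theorem _root_.Literature.Analysis.FunctionSpaces.Torus.IsSmoothSpaceTimeOn.antidivergence
    {S : Set ℝ} (hS : Convex ℝ S) (hSi : (interior S).Nonempty)
    {f : ℝ → UnitAddTorus d → EuclideanSpace ℝ d} (hf : IsSmoothSpaceTimeOn S f) :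
    IsSmoothSpaceTimeOn S (fun t => antidivergence (f t)) := by
  have hU : UniqueDiffOn ℝ S := uniqueDiffOn_convex hS hSi
  have hu : ∀ j, IsSmoothSpaceTimeOn S (fun t => antidivPotential (f t) j) := fun j =>
    (hf.apply j).invLaplacian hS hSi
  have hD : IsSmoothSpaceTimeOn S (fun t => antidivDiv (f t)) :=
    IsSmoothSpaceTimeOn.sum fun l _ => (hu l).partialDeriv hU l
  have hφ : IsSmoothSpaceTimeOn S (fun t => antidivPhi (f t)) := hD.invLaplacian hS hSi
  have hite : ∀ i j : d, IsSmoothSpaceTimeOn S (fun t x => if i = j then antidivDiv (f t) x else 0) := by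
    intro i j
    by_cases hij : i = j
    · simp only [if_pos hij]
      exact hD
    · simp only [if_neg hij]
      exact isSmoothSpaceTimeOn_const (isSmooth_const _) S
  have hE : ∀ i j : d, IsSmoothSpaceTimeOn S (fun t => antidivEntry (f t) i j) := by
    intro i j
    have hA := (hu j).partialDeriv hU i
    have hB := (hu i).partialDeriv hU j
    have hP := (hφ.partialDeriv hU j).partialDeriv hU i
    have h := ((hA.add hB).sub ((hite i j).const_smul (1 / ((Fintype.card d : ℝ) - 1)))).add
      (hP.const_smul ((2 - (Fintype.card d : ℝ)) / ((Fintype.card d : ℝ) - 1)))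
    exact h
  unfold IsSmoothSpaceTimeOn
  exact contDiffOn_pi.2 fun j => contDiffOn_piLp' _ fun i => hE i j

end Antidivergence

end Torus

end Literature.Analysis.FluidPDE
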